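import Summits.Ventures.Crystal3D.Theorems.StickyWulffConstantTextureLiminfFluxZigzag
import HarnessLib

/-!
# The zigzag polyline for an ABSTRACT step selector (any e-best bond per bilayer, any tie-break)
# (lane T, flux count — interface with lane G's walk machine; crux `TextureLiminf`, stmt-Ventures-19483)

HONEST FRAMING. Venture `Summits/Ventures/Crystal3D` (cell `crystal3d-full`), helper `--supports` the crux
`TextureLiminf` (stmt-Ventures-19483) of `route-Ventures-StickyWulffConstant`, registered line `TexShadow` (v6.7; cf-p1
ROUTE.md §86(61) BD ruling 15:54Z: «abstract step selector»).  Rung credit only; F-C1 not moved.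

`…FluxZigzag` / `…FluxCount` / `…CellFlux` are stated for the concrete selector `modelStep` (tie-break `best3`).  Lane G's
walk machine breaks ties among equal-rise `∇`-cappers by `Classical.choose` (`bestCapper`), so at non-generic orientations
its zigzag lines may differ from `zigVertex`'s.  The flux count uses only three facts about the step of bilayer `i`: it is
one of the three e-UPWARD inter-layer bonds of that bilayer (`IsUpBond`), and its rise is `bilayerRise … i`.  This file
restates the polyline over any selector with these properties:

* `IsUpBond L σ e i d`, `IsZigSelector L σ e step`; `IsUpBond.norm_eq_one`, `IsUpBond.apply_two`,
  `IsUpBond.add_mem_barlowLayer` / `IsUpBond.sub_mem_barlowLayer`; `isUpBond_modelStep`, `isZigSelector_modelStep`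
  (the concrete selector is an instance);
* `zigFwdS`, `zigBwdS`, `zigVertexS step`, `zigVertexS_succ`, `zigVertexS_mem_barlowLayer`, `zigVertexS_apply_two`,
  `zigVertexS_add_lattice_mem(_stacking)` — the polyline of the selector consists of sites, one per layer.
The selector forms of `plate_lines_ge_flux` / `cell_charge_le_lines` follow in `…FluxCountSel` / `…CellFluxSel`.
WHAT THIS IS NOT: not the flux count; F-C1 not moved.
-/

noncomputable section

namespace Summit.Ventures.Crystal3D.Theorems

open scoped InnerProductSpace
open Literature.MathematicalPhysics.StatisticalMechanics (barlowPos barlowLayer barlowStacking constHagg haggLabel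
  IsHaggSeq triangularVec₁ triangularVec₂ basalMirror basalMirror_apply_coord barlowPos_apply_two)
open Summit.Ventures.Crystal3D.Cruxes.TextureLiminf.TexShadow (E3 stacking bilayerRise)

/-! ## Upward bonds and selectors -/

/-- `d` is one of the three e-UPWARD inter-layer bonds of bilayer `i` of the stacking `(L, σ)`:
`axisSign • w` (`σ i = 1`) resp. `axisSign • M(−w)` for a reference upper slot `w = barlowPos … constHagg 1 a b`,
`(a, b) ∈ {(0,0), (−1,0), (0,−1)}`. -/
def IsUpBond (L : E3 ≃ₗᵢ[ℝ] E3) (σ : ℤ → ℤ) (e : E3) (i : ℤ) (d : E3) : Prop :=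
  ∃ a b : ℤ, ((a = 0 ∧ b = 0) ∨ (a = -1 ∧ b = 0) ∨ (a = 0 ∧ b = -1)) ∧
    d = axisSign L e • (if σ i = 1 then barlowPos 1 (Real.sqrt (2 / 3)) constHagg 1 a b
      else basalMirror (-barlowPos 1 (Real.sqrt (2 / 3)) constHagg 1 a b))

/-- **A zigzag step selector**: step `k` is an e-upward bond of the bilayer `zigSlab k` with the best rise. -/
def IsZigSelector (L : E3 ≃ₗᵢ[ℝ] E3) (σ : ℤ → ℤ) (e : E3) (step : ℤ → E3) : Prop :=
  ∀ k : ℤ, IsUpBond L σ e (zigSlab L e k) (step k) ∧ ⟪step k, L.symm e⟫_ℝ = bilayerRise L σ e (zigSlab L e k)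

/-- A reference upper slot is a unit vector of height `√(2/3)`. -/
theorem refSlot_spec (a b : ℤ) (hab : (a = 0 ∧ b = 0) ∨ (a = -1 ∧ b = 0) ∨ (a = 0 ∧ b = -1)) :
    ‖barlowPos 1 (Real.sqrt (2 / 3)) constHagg 1 a b‖ = 1 ∧ barlowPos 1 (Real.sqrt (2 / 3)) constHagg 1 a b 2 = Real.sqrt (2 / 3) := by
  refine ⟨?_, by simp [barlowPos_apply_two]⟩
  apply norm_eq_one_of_mem_fccSlots
  rw [fccSlots, Finset.mem_image]
  rcases hab with ⟨rfl, rfl⟩ | ⟨rfl, rfl⟩ | ⟨rfl, rfl⟩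
  · exact ⟨(1, 0, 0), by simp [fccSlotTriples], rfl⟩
  · exact ⟨(1, -1, 0), by simp [fccSlotTriples], rfl⟩
  · exact ⟨(1, 0, -1), by simp [fccSlotTriples], rfl⟩

namespace IsUpBond

variable {L : E3 ≃ₗᵢ[ℝ] E3} {σ : ℤ → ℤ} {e : E3} {i : ℤ} {d : E3}

/-- An upward bond is a unit vector. -/
theorem norm_eq_one (h : IsUpBond L σ e i d) : ‖d‖ = 1 := by
  obtain ⟨a, b, hab, rfl⟩ := h
  obtain ⟨hn, -⟩ := refSlot_spec a b hab
  rw [norm_smul, Real.norm_eq_abs, abs_axisSign, one_mul]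
  split_ifs
  · exact hn
  · rw [LinearIsometryEquiv.norm_map, norm_neg, hn]

/-- Its model height is `axisSign · √(2/3)`. -/
theorem apply_two (h : IsUpBond L σ e i d) : d 2 = axisSign L e * Real.sqrt (2 / 3) := by
  obtain ⟨a, b, hab, rfl⟩ := h
  obtain ⟨-, h2⟩ := refSlot_spec a b hab
  rw [PiLp.smul_apply, smul_eq_mul]
  split_ifs
  · rw [h2]
  · rw [basalMirror_apply_coord, if_pos rfl, PiLp.neg_apply, neg_neg, h2]

/-- **Adding an upward bond maps a layer to the adjacent layer, e-upward** (Hägg words). -/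
theorem add_mem_barlowLayer (hσ : IsHaggSeq σ) (h : IsUpBond L σ e i d) (q : E3) :
    (0 ≤ (L.symm e) 2 → q ∈ barlowLayer 1 (Real.sqrt (2 / 3)) σ i → q + d ∈ barlowLayer 1 (Real.sqrt (2 / 3)) σ (i + 1)) ∧
    (¬ 0 ≤ (L.symm e) 2 → q ∈ barlowLayer 1 (Real.sqrt (2 / 3)) σ (i + 1) → q + d ∈ barlowLayer 1 (Real.sqrt (2 / 3)) σ i) := by
  obtain ⟨a, b, -, rfl⟩ := h
  constructor
  · rintro hs ⟨x, y, rfl⟩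
    rw [axisSign, if_pos hs, one_smul]
    rcases hσ i with h1 | h1
    · rw [if_pos h1, barlowPos_add_upSlot σ i h1]; exact ⟨_, _, rfl⟩
    · rw [if_neg (by rw [h1]; norm_num), barlowPos_add_mirror_upSlot σ i h1]; exact ⟨_, _, rfl⟩
  · rintro hs ⟨x, y, rfl⟩
    rw [axisSign, if_neg hs, neg_one_smul]
    rcases hσ i with h1 | h1
    · rw [if_pos h1]
      refine ⟨x - a, y - b, ?_⟩
      have := barlowPos_add_upSlot σ i h1 (x - a) (y - b) a b
      rw [sub_add_cancel, sub_add_cancel] at this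
      rw [← this]; abel
    · rw [if_neg (by rw [h1]; norm_num)]
      refine ⟨x + a, y + b, ?_⟩
      have := barlowPos_add_mirror_upSlot σ i h1 (x + a) (y + b) a b
      rw [add_sub_cancel_right, add_sub_cancel_right] at this
      rw [← this]; abel

/-- **Subtracting an upward bond maps back.** -/
theorem sub_mem_barlowLayer (hσ : IsHaggSeq σ) (h : IsUpBond L σ e i d) (q : E3) :
    (0 ≤ (L.symm e) 2 → q ∈ barlowLayer 1 (Real.sqrt (2 / 3)) σ (i + 1) → q - d ∈ barlowLayer 1 (Real.sqrt (2 / 3)) σ i) ∧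
    (¬ 0 ≤ (L.symm e) 2 → q ∈ barlowLayer 1 (Real.sqrt (2 / 3)) σ i → q - d ∈ barlowLayer 1 (Real.sqrt (2 / 3)) σ (i + 1)) := by
  obtain ⟨a, b, -, rfl⟩ := h
  constructor
  · rintro hs ⟨x, y, rfl⟩
    rw [axisSign, if_pos hs, one_smul]
    rcases hσ i with h1 | h1
    · rw [if_pos h1]
      refine ⟨x - a, y - b, ?_⟩
      have := barlowPos_add_upSlot σ i h1 (x - a) (y - b) a b
      rw [sub_add_cancel, sub_add_cancel] at this
      rw [← this]; abel
    · rw [if_neg (by rw [h1]; norm_num)]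
      refine ⟨x + a, y + b, ?_⟩
      have := barlowPos_add_mirror_upSlot σ i h1 (x + a) (y + b) a b
      rw [add_sub_cancel_right, add_sub_cancel_right] at this
      rw [← this]; abel
  · rintro hs ⟨x, y, rfl⟩
    rw [axisSign, if_neg hs, neg_one_smul, sub_neg_eq_add]
    rcases hσ i with h1 | h1
    · rw [if_pos h1, barlowPos_add_upSlot σ i h1]; exact ⟨_, _, rfl⟩
    · rw [if_neg (by rw [h1]; norm_num), barlowPos_add_mirror_upSlot σ i h1]; exact ⟨_, _, rfl⟩

end IsUpBond

/-- The concrete step `modelStep` is an upward bond. -/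
theorem isUpBond_modelStep (L : E3 ≃ₗᵢ[ℝ] E3) (σ : ℤ → ℤ) (e : E3) (i : ℤ) : IsUpBond L σ e i (modelStep L σ e i) := by
  obtain ⟨-, -, a, b, hab, hw⟩ := bestUpSlot_spec L σ e i
  exact ⟨a, b, hab, by rw [modelStep, hw]⟩

/-- **The concrete selector `k ↦ modelStep … (zigSlab k)` is a zigzag step selector.** -/
theorem isZigSelector_modelStep (L : E3 ≃ₗᵢ[ℝ] E3) (σ : ℤ → ℤ) (e : E3) :
    IsZigSelector L σ e (fun k => modelStep L σ e (zigSlab L e k)) :=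
  fun k => ⟨isUpBond_modelStep L σ e (zigSlab L e k), inner_modelStep L σ e (zigSlab L e k)⟩

/-! ## The polyline of a selector -/

section Polyline

variable (step : ℤ → E3)

/-- Forward recursion from the origin. -/
def zigFwdS : ℕ → E3
  | 0 => 0
  | n + 1 => zigFwdS n + step n

/-- Backward recursion from the origin. -/
def zigBwdS : ℕ → E3
  | 0 => 0
  | n + 1 => zigBwdS n - step (-((n : ℤ) + 1))

/-- **The zigzag polyline of the selector**: vertex `k`. -/
def zigVertexS (k : ℤ) : E3 := if 0 ≤ k then zigFwdS step k.toNat else zigBwdS step (-k).toNat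

/-- Vertex `0` is the origin. -/
theorem zigVertexS_zero : zigVertexS step 0 = 0 := by simp [zigVertexS, zigFwdS]

/-- **Consecutive vertices differ by the step.** -/
theorem zigVertexS_succ (k : ℤ) : zigVertexS step (k + 1) = zigVertexS step k + step k := by
  rcases le_or_gt 0 k with hk | hk
  · obtain ⟨n, rfl⟩ := Int.eq_ofNat_of_zero_le hk
    have h1 : ((n : ℤ) + 1).toNat = n + 1 := by
      rw [show ((n : ℤ) + 1) = ((n + 1 : ℕ) : ℤ) by push_cast; rfl, Int.toNat_natCast]
    simp only [zigVertexS, Int.natCast_nonneg, if_true, Int.toNat_natCast,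
      show (0 : ℤ) ≤ (n : ℤ) + 1 by positivity, h1, zigFwdS]
  · obtain ⟨n, hn⟩ : ∃ n : ℕ, k = -((n : ℤ) + 1) := ⟨(-k - 1).toNat, by omega⟩
    subst hn
    rcases n with _ | n
    · simp [zigVertexS, zigBwdS, zigFwdS]
    · have h1 : ¬ (0 : ℤ) ≤ -((((n + 1 : ℕ) : ℤ)) + 1) := by push_cast; omega
      have h2 : ¬ (0 : ℤ) ≤ -((((n + 1 : ℕ) : ℤ)) + 1) + 1 := by push_cast; omega
      have h3 : (-(-((((n + 1 : ℕ) : ℤ)) + 1) + 1)).toNat = n + 1 := by push_cast; omega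
      have h4 : (-(-((((n + 1 : ℕ) : ℤ)) + 1))).toNat = n + 2 := by push_cast; omega
      simp only [zigVertexS, h1, h2, if_false, h3, h4, zigBwdS]
      push_cast
      abel

end Polyline

/-! ## The polyline consists of sites -/

section Sites

variable (L : E3 ≃ₗᵢ[ℝ] E3) {σ : ℤ → ℤ} (hσ : IsHaggSeq σ) (e : E3) {step : ℤ → E3} (hsel : IsZigSelector L σ e step)

include hσ hsel in
/-- The forward and backward vertices are sites of the expected layers. -/
theorem zigFwdS_zigBwdS_mem (n : ℕ) :
    zigFwdS step n ∈ barlowLayer 1 (Real.sqrt (2 / 3)) σ (zigLayer L e n) ∧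
      zigBwdS step n ∈ barlowLayer 1 (Real.sqrt (2 / 3)) σ (zigLayer L e (-(n : ℤ))) := by
  induction n with
  | zero =>
    have h0 : zigLayer L e 0 = 0 := by simp [zigLayer]
    have h0' : zigLayer L e (-0) = 0 := by simp [zigLayer]
    rw [Nat.cast_zero, h0, h0']
    exact ⟨zero_mem_barlowLayer_zero' σ, zero_mem_barlowLayer_zero' σ⟩
  | succ n ih =>
    obtain ⟨ihf, ihb⟩ := ih
    constructor
    · show zigFwdS step n + step n ∈ _
      have hb := (hsel n).1
      by_cases hs : 0 ≤ (L.symm e) 2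
      · have hl : zigLayer L e n = n := by simp [zigLayer, hs]
        have hl' : zigLayer L e ((n + 1 : ℕ) : ℤ) = n + 1 := by simp [zigLayer, hs]
        have hsl : zigSlab L e n = n := by simp [zigSlab, hs]
        rw [hl] at ihf; rw [hl']; rw [hsl] at hb
        exact (hb.add_mem_barlowLayer hσ _).1 hs ihf
      · have hl : zigLayer L e n = -n := by simp [zigLayer, hs]
        have hl' : zigLayer L e ((n + 1 : ℕ) : ℤ) = -(n + 1) := by simp [zigLayer, hs]
        have hsl : zigSlab L e n = -n - 1 := by simp [zigSlab, hs]
        rw [hl] at ihf; rw [hl']; rw [hsl] at hb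
        have h := (hb.add_mem_barlowLayer hσ (zigFwdS step n)).2 hs
        rw [show (-(n : ℤ) - 1 + 1) = -n by ring] at h
        rw [show (-((n : ℤ) + 1)) = -n - 1 by ring]
        exact h ihf
    · show zigBwdS step n - step (-((n : ℤ) + 1)) ∈ _
      have hb := (hsel (-((n : ℤ) + 1))).1
      by_cases hs : 0 ≤ (L.symm e) 2
      · have hl : zigLayer L e (-(n : ℤ)) = -n := by simp [zigLayer, hs]
        have hl' : zigLayer L e (-((n + 1 : ℕ) : ℤ)) = -(n + 1) := by simp [zigLayer, hs]
        have hsl : zigSlab L e (-((n : ℤ) + 1)) = -(n + 1) := by simp [zigSlab, hs]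
        rw [hl] at ihb; rw [hl']; rw [hsl] at hb
        have h := (hb.sub_mem_barlowLayer hσ (zigBwdS step n)).1 hs
        rw [show (-((n : ℤ) + 1) + 1) = -n by ring] at h
        exact h ihb
      · have hl : zigLayer L e (-(n : ℤ)) = n := by simp [zigLayer, hs]
        have hl' : zigLayer L e (-((n + 1 : ℕ) : ℤ)) = n + 1 := by simp [zigLayer, hs]
        have hsl : zigSlab L e (-((n : ℤ) + 1)) = n := by simp [zigSlab, hs]
        rw [hl] at ihb; rw [hl']; rw [hsl] at hb
        exact (hb.sub_mem_barlowLayer hσ (zigBwdS step n)).2 hs ihb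

include hσ hsel in
/-- **Every vertex is a site of its layer.** -/
theorem zigVertexS_mem_barlowLayer (k : ℤ) :
    zigVertexS step k ∈ barlowLayer 1 (Real.sqrt (2 / 3)) σ (zigLayer L e k) := by
  rcases le_or_gt 0 k with hk | hk
  · obtain ⟨n, rfl⟩ := Int.eq_ofNat_of_zero_le hk
    simp only [zigVertexS, Int.natCast_nonneg, if_true, Int.toNat_natCast]
    exact (zigFwdS_zigBwdS_mem L hσ e hsel n).1
  · obtain ⟨n, rfl⟩ : ∃ n : ℕ, k = -(n : ℤ) := ⟨(-k).toNat, by omega⟩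
    have h1 : ¬ (0 : ℤ) ≤ -(n : ℤ) := by omega
    simp only [zigVertexS, h1, if_false, neg_neg, Int.toNat_natCast]
    exact (zigFwdS_zigBwdS_mem L hσ e hsel n).2

include hσ hsel in
/-- The model height of vertex `k`. -/
theorem zigVertexS_apply_two (k : ℤ) : zigVertexS step k 2 = (zigLayer L e k : ℝ) * Real.sqrt (2 / 3) := by
  obtain ⟨x, y, h⟩ := zigVertexS_mem_barlowLayer L hσ e hsel k
  rw [h, barlowPos_apply_two]

include hσ hsel in
/-- **The lattice translates of the polyline are sites** of layer `zigLayer k`. -/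
theorem zigVertexS_add_lattice_mem (k : ℤ) (t : Fin 2 → ℤ) :
    zigVertexS step k + ((t 0 : ℝ) • triangularVec₁ 1 + (t 1 : ℝ) • triangularVec₂ 1) ∈
      barlowLayer 1 (Real.sqrt (2 / 3)) σ (zigLayer L e k) := by
  obtain ⟨x, y, h⟩ := zigVertexS_mem_barlowLayer L hσ e hsel k
  refine ⟨x + t 0, y + t 1, ?_⟩
  rw [h]
  simp only [barlowPos]
  push_cast
  module

include hσ hsel in
/-- In the cell: `L (zigVertexS k + t₀ u + t₁ v) + s ∈ stacking L s σ`. -/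
theorem zigVertexS_add_lattice_mem_stacking (s : E3) (k : ℤ) (t : Fin 2 → ℤ) :
    L (zigVertexS step k + ((t 0 : ℝ) • triangularVec₁ 1 + (t 1 : ℝ) • triangularVec₂ 1)) + s ∈ stacking L s σ := by
  obtain ⟨x, y, h⟩ := zigVertexS_add_lattice_mem L hσ e hsel k t
  exact ⟨_, ⟨zigLayer L e k, x, y, h⟩, rfl⟩

include hsel in
/-- The rise, length and model height of step `k` of a selector. -/
theorem IsZigSelector.spec (k : ℤ) :
    ⟪step k, L.symm e⟫_ℝ = bilayerRise L σ e (zigSlab L e k) ∧ ‖step k‖ = 1 ∧ step k 2 = axisSign L e * Real.sqrt (2 / 3) :=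
  ⟨(hsel k).2, (hsel k).1.norm_eq_one, (hsel k).1.apply_two⟩

end Sites

end Summit.Ventures.Crystal3D.Theorems

end
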